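import Literature.Topology.FourManifolds.BordismFourTransitivity
import Literature.Topology.FourManifolds.CollarTheoremGeneral
import Literature.AlgebraicTopology.Homotopy.CollaredHomotopyEquivalence
import Literature.AlgebraicTopology.Homotopy.StrongDeformationRetractUnion
import Literature.AlgebraicTopology.Homotopy.StrongDeformationRetractTransport
import HarnessLib

/-!
# h-cobordism is transitive: the ends of an h-cobordism are strong deformation retracts, and the
# composite of two h-cobordisms is an h-cobordism

Topic `Literature/Topology/FourManifolds`; sibling proof file of `Cobordism.lean` for the named fact
`Literature.Topology.FourManifolds.IsHCobordant.trans` (*h-cobordism is transitive*: Kervaire–Milnor,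
*Groups of homotopy spheres I*, Ann. of Math. 77 (1963), §1, p. 504: h-cobordism "is an
equivalence relation"; Milnor, *Lectures on the h-cobordism theorem* (1965), Thm. 1.4 for
the gluing), in the case in which it is instantiated in the tree — closed smooth manifolds of
positive dimension `n + 1` (`IsHCobordant.trans_succ`), exactly as the tree's
`IsCobordant.trans_succ` (`BordismFourTransitivity.lean`) renders `IsCobordant.trans`.  Everything
here is PROVED; no definition and no named fact is introduced.

## The printed argument and its rendering

Kervaire–Milnor define (§1, p. 504): "Two closed `n`-manifolds `M₁` and `M₂` are h-cobordant if the
disjoint sum `M₁ + (-M₂)` is the boundary of some manifold `W`, where both `M₁` and `(-M₂)` are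
deformation retracts of `W`.  It is clear that this is an equivalence relation."  For this
definition transitivity is indeed clear: glue `W₁ ∪_N W₂` (Milnor
1965, Thm. 1.4) and compose the deformation retractions.  The tree's `Cobordism.IsHCobordism`
is Milnor's later definition (1965, §1 and §9): *the inclusions of the two ends are homotopy
equivalences*.  The bridge is Hatcher, *Algebraic Topology* (2002), Cor. 0.20 with Example 0.15:
the boundary of a smooth manifold is collared (the tree's collar theorem
`BoundaryData.nonempty_collar_holds`, `CollarTheoremGeneral.lean`), and a collared inclusion which
is a homotopy equivalence is a strong deformation retract — proved in the tree for collared covers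
in `Literature/AlgebraicTopology/Homotopy/CollaredHomotopyEquivalence.lean`
(`CollaredCover.exists_deformation`).  Accordingly:

* §1 `IsHomotopyEquiv.of_isStrongDeformationRetractOf_range` — a topological embedding whose
  range is a strong deformation retract of the target is a homotopy equivalence (Hatcher, Ch. 0,
  p. 3).
* §2 `Cobordism.isStrongDeformationRetractOf_range_inl` / `…_inr` — **an end of a cobordism whose
  inclusion is a homotopy equivalence is a strong deformation retract of the cobordism**
  (Kervaire–Milnor's definition recovered from Milnor's): the collared cover of `W` with pieces
  `inl (M)` and `W`, collar the manifold collar of `∂W = M ⊔ N` restricted to `M`.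
* §3 `IsHCobordant.trans_succ` — **h-cobordism is transitive** for closed smooth manifolds of
  dimension `n + 1`.  The composite is the attachment `V = W₁ ∪_{∂W₁ = M ⊔ N} ((M × [0,1]) ⊔ W₂)`
  of `IsCobordant.trans_succ` (`exists_cobordismAttachment_holds`, Milnor's Thm. 1.4, with the
  cylinder `cylinderCobordism`, itself an h-cobordism, `cylinderCobordism_isHCobordism`), read as a
  cobordism from `M × {1}` to `P`.  Its three closed pieces `W₁`, `M × [0,1]`, `W₂` meet along
  `M × {0} = inl M ⊆ W₁` and `N ⊆ W₁, W₂`; by §2 (transported along the embeddings of the pieces,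
  `IsStrongDeformationRetractOf.image_of_isEmbedding`) and the pasting and composition of strong
  deformation retractions (`IsStrongDeformationRetractOf.union_of_inter_subset`, `.trans`),
  `V` strong deformation retracts onto `W₁ ∪ M × [0,1]` (`W₂` onto `N`), this onto `M × [0,1]`
  (`W₁` onto `M × {0}`), this onto `M × {1}`; and `V` onto `W₂` (`M × [0,1]` onto `M × {0}`, then
  `W₁` onto `N`), `W₂` onto `P`.  By §1 both end inclusions of `V` are homotopy equivalences.

The named fact `IsHCobordant.trans` itself is stated for bare charted spaces in every dimension
`n`; like `IsCobordant.trans_succ` this file proves its case of interest and is not an exact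
discharge (in total dimension `1` neither the collar nor the attachment structure exists in the
tree, see `BoundaryData.nonempty_collar` and `exists_cobordismAttachment`).  Users of the fact at
`n = 4` (`WallStabilisation.lean`, `ThetaFour.lean`,
`Barriers/SmoothPoincare4/HCobordismInvariantsBlindProofs.lean`) take
`htrans : IsHCobordant.trans (n := 4) …`, which `fun h₁ h₂ => h₁.trans_succ h₂` inhabits.

## References

* M. Kervaire, J. Milnor, *Groups of homotopy spheres I*, Ann. of Math. (2) 77 (1963) 504–537,
  §1 (p. 504). [KervaireMilnorAnnals1963]
* J. Milnor, *Lectures on the h-cobordism theorem*, Princeton (1965), §1, Thm. 1.4.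
  [MilnorHCobordism1965]
* A. Hatcher, *Algebraic Topology*, CUP (2002), Ch. 0: p. 3, Example 0.15, Prop. 0.19, Cor. 0.20.
  [HatcherAT2002]
-/

noncomputable section

open scoped Manifold ContDiff Topology unitInterval
open Set Function Topology
open Literature.AlgebraicTopology.Homotopy

universe u

namespace Literature.Topology.FourManifolds

/-! ### §1 An embedding onto a strong deformation retract is a homotopy equivalence -/

section General

variable {X Y : Type*} [TopologicalSpace X] [TopologicalSpace Y]

/-- **An embedding whose range is a strong deformation retract of the target is a homotopy
equivalence** (Hatcher, *Algebraic Topology* (2002), Ch. 0, p. 3: a deformation retraction of `Y`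
onto `A` makes the inclusion `A ↪ Y` a homotopy equivalence with homotopy inverse the retraction;
composed with the homeomorphism `X ≅ f(X)`). [cite: HatcherAT2002, Ch. 0, p. 3] -/
theorem IsHomotopyEquiv.of_isStrongDeformationRetractOf_range {f : X → Y} (hf : IsEmbedding f)
    (h : IsStrongDeformationRetractOf (range f) (univ : Set Y)) : IsHomotopyEquiv f := by
  obtain ⟨H, h0, h1, hfix⟩ := h
  -- the deformation as a map `I × Y → Y`
  let Ht : I × Y → Y := fun p => (H (p.1, ⟨p.2, mem_univ _⟩) : Y)
  have hHt : Continuous Ht :=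
    continuous_subtype_val.comp (H.continuous.comp (continuous_fst.prodMk
      (continuous_snd.subtype_mk _)))
  have hHt0 : ∀ y, Ht (0, y) = y := fun y => congrArg Subtype.val (h0 ⟨y, mem_univ _⟩)
  have hHt1 : ∀ y, Ht (1, y) ∈ range f := fun y => h1 ⟨y, mem_univ _⟩
  have hHtfix : ∀ (t : I) (x : X), Ht (t, f x) = f x := fun t x =>
    congrArg Subtype.val (hfix t ⟨f x, mem_univ _⟩ (mem_range_self x))
  -- the retraction `Y → X`
  let e : X ≃ₜ ↥(range f) := hf.toHomeomorph
  have hfe : ∀ z : ↥(range f), f (e.symm z) = z := fun z => by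
    rw [← hf.toHomeomorph_apply_coe (e.symm z)]
    exact congrArg Subtype.val (e.apply_symm_apply z)
  have hef : ∀ x : X, e.symm ⟨f x, mem_range_self x⟩ = x := fun x => by
    apply hf.injective
    rw [hfe]
  let r : Y → X := fun y => e.symm ⟨Ht (1, y), hHt1 y⟩
  have hr : Continuous r :=
    e.symm.continuous.comp ((hHt.comp (Continuous.prodMk_right 1)).subtype_mk _)
  have hrf : ∀ x, r (f x) = x := fun x => by
    show e.symm ⟨Ht (1, f x), hHt1 (f x)⟩ = x
    have : (⟨Ht (1, f x), hHt1 (f x)⟩ : ↥(range f)) = ⟨f x, mem_range_self x⟩ :=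
      Subtype.ext (hHtfix 1 x)
    rw [this, hef]
  have hfr : ∀ y, f (r y) = Ht (1, y) := fun y => hfe _
  refine ⟨{ toFun := ⟨f, hf.continuous⟩
            invFun := ⟨r, hr⟩
            left_inv := ?_
            right_inv := ?_ }, rfl⟩
  · have hcomp : (⟨r, hr⟩ : C(Y, X)).comp ⟨f, hf.continuous⟩ = ContinuousMap.id X := by
      ext x
      exact hrf x
    rw [hcomp]
  · refine ⟨{ toFun := fun p => Ht (σ p.1, p.2)
              continuous_toFun := hHt.comp ((unitInterval.continuous_symm.comp
                continuous_fst).prodMk continuous_snd)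
              map_zero_left := fun y => ?_
              map_one_left := fun y => ?_ }⟩
    · show Ht (σ 0, y) = f (r y)
      rw [unitInterval.symm_zero, hfr]
    · show Ht (σ 1, y) = y
      rw [unitInterval.symm_one, hHt0]

end General

/-! ### §2 The ends of an h-cobordism are strong deformation retracts -/

section Ends

variable {n : ℕ} {M N : Type u}
  [TopologicalSpace M] [ChartedSpace (EuclideanSpace ℝ (Fin (n + 1))) M]
  [TopologicalSpace N] [ChartedSpace (EuclideanSpace ℝ (Fin (n + 1))) N]

/-- **An incoming end whose inclusion is a homotopy equivalence is a strong deformation retract of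
the cobordism** (Kervaire–Milnor 1963, §1, p. 504: "both `M₁` and `-M₂` are deformation retracts
of `W`", recovered from Milnor's definition of an h-cobordism by Hatcher's Cor. 0.20 for the
collared pair `(W, inl M)`): for a cobordism `W` from `M` to `N` between smooth manifolds of
dimension `n + 1` with compact ends, if `inl : M → W` is a homotopy equivalence then `inl (M)` is a
strong deformation retract of `W`.  The collar of `inl (M)` is the manifold collar of
`∂W = M ⊔ N` (`BoundaryData.nonempty_collar_holds`) restricted to `M`; the deformation is
`CollaredCover.exists_deformation` for the cover of `W` by `inl (M)` and `W`.
[cite: KervaireMilnorAnnals1963, §1 (p. 504)] [cite: HatcherAT2002, Cor. 0.20 with Example 0.15] -/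
theorem Cobordism.isStrongDeformationRetractOf_range_inl [CompactSpace M] [CompactSpace N]
    [IsManifold (𝓡 (n + 1)) ∞ M] [IsManifold (𝓡 (n + 1)) ∞ N]
    (c : Cobordism (n + 1) M N) (h : IsHomotopyEquiv c.inl) :
    IsStrongDeformationRetractOf (range c.inl) (univ : Set c.W) := by
  obtain ⟨e, he⟩ := h
  rcases isEmpty_or_nonempty M with hM | hM
  · -- `W ≃ₕ M` is empty: nothing to deform
    haveI : IsEmpty c.W := ⟨fun w => isEmptyElim (e.invFun w)⟩
    exact IsStrongDeformationRetractOf.of_subset fun w _ => isEmptyElim w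
  -- boundary datum `∂W = M ⊔ N` and a collar of it
  let b : BoundaryData (𝓡∂ (n + 2)) c.W (𝓡 (n + 1)) :=
    { carrier := M ⊕ N
      incl := Sum.elim c.inl c.inr
      isSmoothEmbedding := c.isSmoothEmbedding_inl.sumElim c.isSmoothEmbedding_inr
        c.disjoint_range
      range_incl := by rw [Set.Sum.elim_range, c.range_inl_union_range_inr] }
  obtain ⟨κ⟩ := BoundaryData.nonempty_collar_holds n c.W b
  -- the collar of the `M`-end
  let col : M × I → c.W := fun q => κ (Sum.inl q.1, q.2)
  have hcol_cont : Continuous col :=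
    κ.continuous.comp ((_root_.continuous_inl.comp continuous_fst).prodMk continuous_snd)
  have hcol_inj : Injective col := by
    rintro ⟨a, s⟩ ⟨a', s'⟩ hq
    have hq' := κ.injective hq
    simp only [Prod.mk.injEq] at hq'
    rw [Sum.inl_injective hq'.1, hq'.2]
  have hcol_emb : IsClosedEmbedding col := hcol_cont.isClosedEmbedding hcol_inj
  have hcol_zero : ∀ a, col (a, 0) = c.inl a := fun a => κ.apply_bot (Sum.inl a)
  -- the half-open part of the `M`-collar is open in `W`
  have hopen : IsOpen (col '' {q : M × I | q.2 < 1}) := by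
    have hV : IsOpen {p : (M ⊕ N) × I | p.1 ∈ range (Sum.inl : M → M ⊕ N)} :=
      isOpen_range_inl.preimage continuous_fst
    obtain ⟨O, hO, hOV⟩ := κ.isSmoothEmbedding.isEmbedding.isInducing.isOpen_iff.1 hV
    have himg : col '' {q : M × I | q.2 < 1} =
        κ '' ({p : (M ⊕ N) × I | (p.2 : ℝ) < 1} ∩ κ ⁻¹' O) := by
      rw [hOV]
      ext w
      constructor
      · rintro ⟨⟨a, s⟩, hs, rfl⟩
        exact ⟨(Sum.inl a, s), ⟨hs, ⟨a, rfl⟩⟩, rfl⟩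
      · rintro ⟨⟨x, s⟩, ⟨hs, ⟨a, rfl⟩⟩, rfl⟩
        exact ⟨(a, s), hs, rfl⟩
    rw [himg, image_inter_preimage]
    exact κ.isOpen_image.inter hO
  -- the collared cover of `W` by `inl (M)` and `W`
  let cov : CollaredCover c.W M :=
    { left := range c.inl
      right := univ
      isClosed_left := (isCompact_range c.continuous_inl).isClosed
      isClosed_right := isClosed_univ
      union_eq := union_univ _
      collar := col
      isClosedEmbedding_collar := hcol_emb
      collar_mem_right := fun _ => mem_univ _
      collar_zero_mem_left := fun a => ⟨a, (hcol_zero a).symm⟩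
      exists_collar_zero_eq := fun p hp => by
        obtain ⟨a, rfl⟩ := hp.1
        exact ⟨a, hcol_zero a⟩
      isClosed_right_diff := by
        rw [← compl_eq_univ_sdiff]
        exact hopen.isClosed_compl }
  -- the homotopy equivalence `M ≃ₕ W`, read into `cov.right = univ`
  let e' : ContinuousMap.HomotopyEquiv M cov.right :=
    e.trans (Homeomorph.Set.univ c.W).symm.toHomotopyEquiv
  have he' : ∀ a, e'.toFun a = cov.incl a := fun a => by
    apply Subtype.ext
    show e.toFun a = col (a, 0)
    rw [he, hcol_zero]
  obtain ⟨H, hH, hH0, hH1, hHfix⟩ :=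
    cov.exists_deformation (CollaredCover.InclHomotopyInverse.ofHomotopyEquiv cov e' he')
  refine ⟨⟨fun p => H (σ p.1, p.2), hH.comp ((unitInterval.continuous_symm.comp
    continuous_fst).prodMk continuous_snd)⟩, fun z => ?_, fun z => ?_, fun t z hz => ?_⟩
  · show H (σ 0, z) = z
    rw [unitInterval.symm_zero]
    exact hH1 z
  · show (H (σ 1, z) : c.W) ∈ range c.inl
    rw [unitInterval.symm_one, hH0, CollaredCover.coe_incl]
    exact ⟨_, (hcol_zero _).symm⟩
  · obtain ⟨a, ha⟩ := hz
    have hza : z = cov.incl a :=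
      Subtype.ext (by rw [CollaredCover.coe_incl]; exact ha.symm.trans (hcol_zero a).symm)
    show H (σ t, z) = z
    rw [hza, hHfix]

/-- **An outgoing end whose inclusion is a homotopy equivalence is a strong deformation retract
of the cobordism** (the previous theorem for the reversed cobordism). [cite: KervaireMilnorAnnals1963, §1 (p. 504)] [cite: HatcherAT2002, Cor. 0.20 with Example 0.15] -/
theorem Cobordism.isStrongDeformationRetractOf_range_inr [CompactSpace M] [CompactSpace N]
    [IsManifold (𝓡 (n + 1)) ∞ M] [IsManifold (𝓡 (n + 1)) ∞ N]
    (c : Cobordism (n + 1) M N) (h : IsHomotopyEquiv c.inr) :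
    IsStrongDeformationRetractOf (range c.inr) (univ : Set c.W) :=
  c.symm.isStrongDeformationRetractOf_range_inl h

/-- **In an h-cobordism both ends are strong deformation retracts** — Kervaire–Milnor's
definition of h-cobordism (1963, §1, p. 504) from Milnor's (1965, §1). [cite: KervaireMilnorAnnals1963, §1 (p. 504)] -/
theorem Cobordism.IsHCobordism.isStrongDeformationRetractOf_range [CompactSpace M] [CompactSpace N]
    [IsManifold (𝓡 (n + 1)) ∞ M] [IsManifold (𝓡 (n + 1)) ∞ N]
    {c : Cobordism (n + 1) M N} (hc : c.IsHCobordism) :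
    IsStrongDeformationRetractOf (range c.inl) (univ : Set c.W) ∧
      IsStrongDeformationRetractOf (range c.inr) (univ : Set c.W) :=
  ⟨c.isStrongDeformationRetractOf_range_inl hc.1, c.isStrongDeformationRetractOf_range_inr hc.2⟩

end Ends

/-! ### §3 Transitivity of h-cobordism -/

section Trans

variable {n : ℕ} {M N P : Type u}
  [TopologicalSpace M] [ChartedSpace (EuclideanSpace ℝ (Fin (n + 1))) M]
  [TopologicalSpace N] [ChartedSpace (EuclideanSpace ℝ (Fin (n + 1))) N]
  [TopologicalSpace P] [ChartedSpace (EuclideanSpace ℝ (Fin (n + 1))) P]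

/-- **h-cobordism is transitive** (Kervaire–Milnor, *Groups of homotopy spheres I* (1963), §1,
p. 504; the gluing is Milnor 1965, Thm. 1.4), for closed smooth manifolds of positive dimension
`n + 1`: if `M ∼ₕ N` and `N ∼ₕ P` then `M ∼ₕ P`.  The composite cobordism is the attachment
`V = W₁ ∪_{M ⊔ N} ((M × [0, 1]) ⊔ W₂)` of `IsCobordant.trans_succ`, from `M × {1}` to `P`; its end
inclusions are homotopy equivalences because their ranges are strong deformation retracts of `V`
(module docstring, §§1–2).  This is the tree's named fact `IsHCobordant.trans` (`Cobordism.lean`)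
in positive dimension and for closed smooth ends. [cite: KervaireMilnorAnnals1963, §1 (p. 504)] [cite: MilnorHCobordism1965, §1, Thm. 1.4] -/
theorem IsHCobordant.trans_succ [T2Space M] [SecondCountableTopology M]
    [IsManifold (𝓡 (n + 1)) ∞ M] [CompactSpace M] [IsManifold (𝓡 (n + 1)) ∞ N] [CompactSpace N]
    [IsManifold (𝓡 (n + 1)) ∞ P] [CompactSpace P]
    (h₁ : IsHCobordant (n + 1) M N) (h₂ : IsHCobordant (n + 1) N P) :
    IsHCobordant (n + 1) M P := by
  obtain ⟨c₁, hc₁⟩ := h₁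
  obtain ⟨c₂, hc₂⟩ := h₂
  -- `∂W₁ = M ⊔ N` as a boundary datum
  let b : BoundaryData (𝓡∂ (n + 2)) c₁.W (𝓡 (n + 1)) :=
    { carrier := M ⊕ N
      incl := Sum.elim c₁.inl c₁.inr
      isSmoothEmbedding := c₁.isSmoothEmbedding_inl.sumElim c₁.isSmoothEmbedding_inr
        c₁.disjoint_range
      range_incl := by rw [Set.Sum.elim_range, c₁.range_inl_union_range_inr] }
  -- the cylinder on `M`, an h-cobordism
  let C : Cobordism (n + 1) M M := cylinderCobordism (n + 1) M
  have hC : C.IsHCobordism := cylinderCobordism_isHCobordism (n + 1) M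
  -- the cobordism `(M × [0, 1]) ⊔ W₂` from `M ⊔ N` to `M ⊔ P`
  let X : Cobordism (n + 1) (M ⊕ N) (M ⊕ P) :=
    { W := C.W ⊕ c₂.W
      inl := Sum.map C.inl c₂.inl
      inr := Sum.map C.inr c₂.inr
      isSmoothEmbedding_inl := C.isSmoothEmbedding_inl.sumMap c₂.isSmoothEmbedding_inl
      isSmoothEmbedding_inr := C.isSmoothEmbedding_inr.sumMap c₂.isSmoothEmbedding_inr
      disjoint_range := C.disjoint_range_sumMap c₂
      range_inl_union_range_inr := C.range_sumMap_union_range_sumMap c₂ }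
  -- attach it to `W₁` along the identity of `M ⊔ N`
  obtain ⟨V, _, _, _, _, _, ⟨A⟩⟩ := exists_cobordismAttachment_holds n c₁.W b (M ⊕ N) (M ⊕ P) X
    (Diffeomorph.refl (𝓡 (n + 1)) (M ⊕ N) ∞)
  haveI : CompactSpace V := A.compactSpace
  -- `∂V = M ⊔ P`: a cobordism from `M` to `P`
  let Y : Cobordism (n + 1) M P :=
    { W := V
      inl := (A.jX ∘ X.inr) ∘ Sum.inl
      inr := (A.jX ∘ X.inr) ∘ Sum.inr
      isSmoothEmbedding_inl := isSmoothEmbedding_comp_inl A.isSmoothEmbedding_jX_comp_inr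
      isSmoothEmbedding_inr := isSmoothEmbedding_comp_inr A.isSmoothEmbedding_jX_comp_inr
      disjoint_range := Set.disjoint_left.2 (by
        rintro _ ⟨x, rfl⟩ ⟨y, hy⟩
        exact Sum.inr_ne_inl (A.isSmoothEmbedding_jX_comp_inr.isEmbedding.injective hy))
      range_inl_union_range_inr := by
        rw [← A.range_jX_comp_inr]
        ext v
        constructor
        · rintro (⟨x, rfl⟩ | ⟨y, rfl⟩)
          · exact ⟨Sum.inl x, rfl⟩
          · exact ⟨Sum.inr y, rfl⟩
        · rintro ⟨x | y, rfl⟩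
          · exact Or.inl ⟨x, rfl⟩
          · exact Or.inr ⟨y, rfl⟩ }
  -- the embeddings of the three pieces `W₁`, `M × [0, 1]`, `W₂`
  let eC : C.W → V := A.jX ∘ Sum.inl
  let e₂ : c₂.W → V := A.jX ∘ Sum.inr
  have hjW : IsEmbedding A.jW := A.isSmoothEmbedding_jW.isEmbedding
  have hjX : IsEmbedding A.jX := A.isSmoothEmbedding_jX.isEmbedding
  have heC : IsEmbedding eC := hjX.comp IsEmbedding.inl
  have he₂ : IsEmbedding e₂ := hjX.comp IsEmbedding.inr
  -- the seams
  have hseam : ∀ w x, A.jW w = A.jX x ↔ ∃ z, w = b.incl z ∧ x = X.inl z := fun w x =>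
    A.jW_eq_jX_iff w x
  have hseam_l : ∀ m, A.jW (c₁.inl m) = eC (C.inl m) := fun m =>
    (hseam (c₁.inl m) (Sum.inl (C.inl m))).2 ⟨Sum.inl m, rfl, rfl⟩
  have hseam_r : ∀ y, A.jW (c₁.inr y) = e₂ (c₂.inl y) := fun y =>
    (hseam (c₁.inr y) (Sum.inr (c₂.inl y))).2 ⟨Sum.inr y, rfl, rfl⟩
  -- the pieces and their intersections, as subsets of `V`
  have hcover : range A.jW ∪ range eC ∪ range e₂ = univ := by
    rw [union_assoc, ← A.range_union]
    congr 1
    ext v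
    constructor
    · rintro (⟨x, rfl⟩ | ⟨y, rfl⟩)
      · exact ⟨Sum.inl x, rfl⟩
      · exact ⟨Sum.inr y, rfl⟩
    · rintro ⟨x | y, rfl⟩
      · exact Or.inl ⟨x, rfl⟩
      · exact Or.inr ⟨y, rfl⟩
  have hWC : range A.jW ∩ range eC ⊆ A.jW '' range c₁.inl := by
    rintro _ ⟨⟨w, rfl⟩, ⟨x, hx⟩⟩
    obtain ⟨z, rfl, hz⟩ := (hseam w (Sum.inl x)).1 hx.symm
    rcases z with m | y
    · exact ⟨c₁.inl m, ⟨m, rfl⟩, rfl⟩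
    · exact absurd hz Sum.inl_ne_inr
  have hW2 : range A.jW ∩ range e₂ ⊆ A.jW '' range c₁.inr := by
    rintro _ ⟨⟨w, rfl⟩, ⟨x, hx⟩⟩
    obtain ⟨z, rfl, hz⟩ := (hseam w (Sum.inr x)).1 hx.symm
    rcases z with m | y
    · exact absurd hz Sum.inr_ne_inl
    · exact ⟨c₁.inr y, ⟨y, rfl⟩, rfl⟩
  have hC2 : range eC ∩ range e₂ = ∅ := by
    rw [eq_empty_iff_forall_notMem]
    rintro _ ⟨⟨x, rfl⟩, ⟨y, hy⟩⟩
    exact Sum.inr_ne_inl (hjX.injective hy)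
  have hM0 : A.jW '' range c₁.inl = eC '' range C.inl := by
    ext v
    constructor
    · rintro ⟨_, ⟨m, rfl⟩, rfl⟩
      exact ⟨C.inl m, ⟨m, rfl⟩, (hseam_l m).symm⟩
    · rintro ⟨_, ⟨m, rfl⟩, rfl⟩
      exact ⟨c₁.inl m, ⟨m, rfl⟩, hseam_l m⟩
  have hN0 : A.jW '' range c₁.inr = e₂ '' range c₂.inl := by
    ext v
    constructor
    · rintro ⟨_, ⟨y, rfl⟩, rfl⟩
      exact ⟨c₂.inl y, ⟨y, rfl⟩, (hseam_r y).symm⟩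
    · rintro ⟨_, ⟨y, rfl⟩, rfl⟩
      exact ⟨c₁.inr y, ⟨y, rfl⟩, hseam_r y⟩
  -- closedness of the pieces
  have hWcl : IsClosed (range A.jW) := (isCompact_range A.continuous_jW).isClosed
  have hCcl : IsClosed (range eC) := (isCompact_range heC.continuous).isClosed
  have h2cl : IsClosed (range e₂) := (isCompact_range he₂.continuous).isClosed
  -- §2 for the five ends, transported into `V`
  have hN2 : IsStrongDeformationRetractOf (A.jW '' range c₁.inr) (range e₂) := by
    have := (c₂.isStrongDeformationRetractOf_range_inl hc₂.1).image_of_isEmbedding he₂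
    rwa [image_univ, ← hN0] at this
  have hM0W : IsStrongDeformationRetractOf (A.jW '' range c₁.inl) (range A.jW) := by
    have := (c₁.isStrongDeformationRetractOf_range_inl hc₁.1).image_of_isEmbedding hjW
    rwa [image_univ] at this
  have hNW : IsStrongDeformationRetractOf (A.jW '' range c₁.inr) (range A.jW) := by
    have := (c₁.isStrongDeformationRetractOf_range_inr hc₁.2).image_of_isEmbedding hjW
    rwa [image_univ] at this
  have hM0C : IsStrongDeformationRetractOf (A.jW '' range c₁.inl) (range eC) := by
    have := (C.isStrongDeformationRetractOf_range_inl hC.1).image_of_isEmbedding heC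
    rwa [image_univ, ← hM0] at this
  have hM1C : IsStrongDeformationRetractOf (eC '' range C.inr) (range eC) := by
    have := (C.isStrongDeformationRetractOf_range_inr hC.2).image_of_isEmbedding heC
    rwa [image_univ] at this
  have hP2 : IsStrongDeformationRetractOf (e₂ '' range c₂.inr) (range e₂) := by
    have := (c₂.isStrongDeformationRetractOf_range_inr hc₂.2).image_of_isEmbedding he₂
    rwa [image_univ] at this
  -- subset bookkeeping
  have hM0subW : A.jW '' range c₁.inl ⊆ range A.jW := image_subset_range _ _
  have hM0subC : A.jW '' range c₁.inl ⊆ range eC := hM0 ▸ image_subset_range _ _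
  have hNsubW : A.jW '' range c₁.inr ⊆ range A.jW := image_subset_range _ _
  have hNsub2 : A.jW '' range c₁.inr ⊆ range e₂ := hN0 ▸ image_subset_range _ _
  -- (A) `V` deformation retracts onto `W₁ ∪ M × [0,1]`, then onto `M × [0,1]`, then onto `M × {1}`
  have hA1 : IsStrongDeformationRetractOf (range A.jW ∪ range eC) univ := by
    have := hN2.union_of_inter_subset (P := range A.jW ∪ range eC)
      (fun v hv => by
        rcases hv.1 with hvW | hvC
        · exact hW2 ⟨hvW, hv.2⟩
        · exact absurd (show v ∈ range eC ∩ range e₂ from ⟨hvC, hv.2⟩) (hC2 ▸ notMem_empty v))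
      (fun v hv => Or.inl (hNsubW hv.1))
      (fun v hv => by rw [(hWcl.union hCcl).closure_eq] at hv; exact hv.1)
      (fun v hv => by rw [h2cl.closure_eq] at hv; exact hv.1)
    rwa [hcover] at this
  have hA2 : IsStrongDeformationRetractOf (range eC) (range A.jW ∪ range eC) := by
    have := hM0W.union_of_inter_subset (P := range eC)
      (fun v hv => hWC ⟨hv.2, hv.1⟩)
      (fun v hv => hM0subC hv.1)
      (fun v hv => by rw [hCcl.closure_eq] at hv; exact hv.1)
      (fun v hv => by rw [hWcl.closure_eq] at hv; exact hv.1)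
    rwa [union_comm] at this
  have hA : IsStrongDeformationRetractOf (eC '' range C.inr) univ :=
    (hA1.trans hA2 (subset_univ _) subset_union_right).trans hM1C (subset_univ _)
      (image_subset_range _ _)
  -- (B) `V` deformation retracts onto `W₂` (through `W₁ ∪ M × [0,1] ↘ W₁ ↘ N`), then onto `P`
  have hB1 : IsStrongDeformationRetractOf (range A.jW) (range A.jW ∪ range eC) :=
    hM0C.union_of_inter_subset (P := range A.jW)
      (fun v hv => hWC hv)
      (fun v hv => hM0subW hv.1)
      (fun v hv => by rw [hWcl.closure_eq] at hv; exact hv.1)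
      (fun v hv => by rw [hCcl.closure_eq] at hv; exact hv.1)
  have hB2 : IsStrongDeformationRetractOf (A.jW '' range c₁.inr) (range A.jW ∪ range eC) :=
    hB1.trans hNW subset_union_left hNsubW
  have hB3 : IsStrongDeformationRetractOf (range e₂) univ := by
    have := hB2.union_of_inter_subset (P := range e₂)
      (fun v hv => by
        rcases hv.2 with hvW | hvC
        · exact hW2 ⟨hvW, hv.1⟩
        · exact absurd (show v ∈ range eC ∩ range e₂ from ⟨hvC, hv.1⟩) (hC2 ▸ notMem_empty v))
      (fun v hv => hNsub2 hv.1)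
      (fun v hv => by rw [h2cl.closure_eq] at hv; exact hv.1)
      (fun v hv => by rw [(hWcl.union hCcl).closure_eq] at hv; exact hv.1)
    rwa [union_comm, hcover] at this
  have hB : IsStrongDeformationRetractOf (e₂ '' range c₂.inr) univ :=
    hB3.trans hP2 (subset_univ _) (image_subset_range _ _)
  -- conclusion: both end inclusions of `Y` are homotopy equivalences
  refine ⟨Y, ?_, ?_⟩
  · have hrange : range Y.inl = eC '' range C.inr := by
      show range (eC ∘ C.inr) = eC '' range C.inr
      exact range_comp eC C.inr
    exact IsHomotopyEquiv.of_isStrongDeformationRetractOf_range Y.isSmoothEmbedding_inl.isEmbedding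
      (hrange ▸ hA)
  · have hrange : range Y.inr = e₂ '' range c₂.inr := by
      show range (e₂ ∘ c₂.inr) = e₂ '' range c₂.inr
      exact range_comp e₂ c₂.inr
    exact IsHomotopyEquiv.of_isStrongDeformationRetractOf_range Y.isSmoothEmbedding_inr.isEmbedding
      (hrange ▸ hB)

/-- **h-cobordism is an equivalence relation on closed smooth manifolds of positive dimension**
(Kervaire–Milnor 1963, §1, p. 504: "It is clear that this is an equivalence relation"):
reflexivity is the cylinder (`isHCobordant_self`), symmetry the reversed cobordism
(`IsHCobordant.symm`), transitivity `IsHCobordant.trans_succ`. [cite: KervaireMilnorAnnals1963, §1 (p. 504)] -/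
theorem IsHCobordant.trans_succ_symm [T2Space M] [SecondCountableTopology M]
    [IsManifold (𝓡 (n + 1)) ∞ M] [CompactSpace M] [IsManifold (𝓡 (n + 1)) ∞ N] [CompactSpace N]
    [IsManifold (𝓡 (n + 1)) ∞ P] [CompactSpace P]
    (h₁ : IsHCobordant (n + 1) M N) (h₂ : IsHCobordant (n + 1) P N) :
    IsHCobordant (n + 1) M P :=
  h₁.trans_succ h₂.symm

end Trans

end Literature.Topology.FourManifolds

end
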